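import Literature.AlgebraicGeometry.Resolution.ArithmeticalThreefoldsLocalDescentMonomializationHead
import Literature.AlgebraicGeometry.Resolution.Prop81Monomialization
import HarnessLib

/-!
# Cossart–Piltant 2019, (C4) `CossartPiltant2019ReductionP`: the chain with the head of [CoP1] Prop. 9.3 DISCHARGED

Topic: `Literature/AlgebraicGeometry/Resolution`. PROOF side of `CossartPiltant2019ReductionP`
(`ArithmeticalThreefoldsLocal.lean`), input (C4). In
`cossartPiltant2019ReductionP_of_cjs_of_stableInertia_of_monomialization`
(`ArithmeticalThreefoldsLocalDescentMonomializationHead.lean`) the head of the decomposition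
layer of [CoP1] Prop. 9.3 ([CoP1] Prop. 8.1 in the model reading plus the choice (46)) was
reduced to ONE hypothesis `hMono` — [CoP1] Prop. 4.1 / Prop. 8.1 (1) for one element along the
valuation with the denominator clause ("`S₁ < S₂`, `(S₁)_f = (S₂)_f` and `f S₂` is monomial",
HAL hal-00139124, p. 22). `exists_monomialization_with_denominators`
(`Prop81Monomialization.lean`) proves `hMono` from the embedded-resolution hypothesis `hEmb`
already present in the chain. This file records the resulting chain
`CossartPiltant2019Local → CossartPiltant2019Principalization → CossartJannsenSaito2020General
→ hEmb → hStabLoc → hStabIη → CossartPiltant2019ReductionP`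
(`cossartPiltant2019ReductionP_of_cjs_of_stableInertia`): besides the printed theorems and the
embedded resolution of surfaces, only the two equivariant-local-uniformization hypotheses
`hStabLoc` (a Galois-stable local uniformization of a cyclic degree-`ℓ` extension with full
inertia) and `hStabIη` (a decomposition-group-stable local uniformization of the inertia field
containing `η`) remain.

Everything is PROVED; no named facts, definitions, instances or notation are introduced.

## Sources

* V. Cossart, O. Piltant, J. Algebra 529 (2019): Props. 4.3, 4.4 and proof of Prop. 4.10
  (arXiv v1: Props. 4.2, 4.3, 4.8). [CossartPiltant2019]
* V. Cossart, O. Piltant, J. Algebra 320 (2008): Prop. 4.1, Prop. 8.1, Prop. 9.3 and their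
  proofs (HAL hal-00139124, pp. 6–7, 22–23, 26–30). [CossartPiltant2008]
-/

noncomputable section

open CategoryTheory AlgebraicGeometry TopologicalSpace IsLocalRing _root_.Polynomial
  _root_.IntermediateField

namespace Literature.AlgebraicGeometry.Resolution

universe u

set_option maxHeartbeats 800000 in
/-- **The chain for (C4) with the head of [CoP1] Prop. 9.3 discharged**: from the local
theorem, principalization, Cossart–Jannsen–Saito, embedded resolution of surfaces in regular
excellent schemes (`hEmb`), and the two equivariant local-uniformization hypotheses `hStabLoc`,
`hStabIη`, the reduction `CossartPiltant2019ReductionP` follows; [CoP1] Prop. 8.1 (1)–(2), the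
choice (46) and the monomialization with denominator control are all proved
(`exists_monomialization_with_denominators`, `head_conclusion_of_monomialization`).
[cite: CossartPiltant2019, Props. 4.3, 4.4 and proof of Prop. 4.10 (arXiv v1: Props. 4.2, 4.3, 4.8, pp. 50–54)]
[cite: CossartPiltant2008, Prop. 4.1, Prop. 8.1, Prop. 9.3 and their proofs (HAL pp. 6–7, 22–23, 26–30)] -/
theorem cossartPiltant2019ReductionP_of_cjs_of_stableInertia
    (hloc : CossartPiltant2019Local.{u}) (h44 : CossartPiltant2019Principalization.{u})
    (hCJS : CossartJannsenSaito2020General.{u})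
    (hEmb : ∀ (Z : Scheme.{u}) [IsIntegral Z] [IsNoetherian Z], Scheme.IsRegular Z →
      Scheme.IsExcellent Z → ∀ (X : Set Z), IsClosed X → X ≠ Set.univ → topologicalKrullDim X ≤ 2 →
        ∃ (Z' : Scheme.{u}) (π : Z' ⟶ Z), IsProper π ∧ Function.Surjective π.base ∧
          (∃ U : Z.Opens, (U : Set Z) = Xᶜ ∧ IsIso (π ∣_ U)) ∧
          IsStrictNormalCrossingsDivisor Z' (π.base ⁻¹' X))
    (hStabLoc :
      ∀ (p : ℕ), p.Prime →
      ∀ (S : Type u) [CommRing S] [IsDomain S] [IsRegularLocalRing S],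
        IsExcellentRing S → ringKrullDim S = 3 → CharP (ResidueField S) p →
        IsAdicComplete (maximalIdeal S) S →
      ∀ (E : Type u) [Field E] [Algebra S E], Function.Injective (algebraMap S E) →
        IsAlgClosed E → Algebra.IsAlgebraic S E →
      ∀ (OE : ValuationSubring E), (∀ s : S, algebraMap S E s ∈ OE) →
        (∀ s ∈ maximalIdeal S, OE.valuation (algebraMap S E s) < 1) →
        (∀ y : OE, ∃ q : S[X], (∃ i, q.coeff i ∉ maximalIdeal S) ∧
          OE.valuation (q.eval₂ (algebraMap S E) y) < 1) →
      Nonempty OE.valuation.RankOne →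
      ∀ (ℓ : ℕ), ℓ.Prime → ℓ ≠ p → ∀ (ζ : E), IsPrimitiveRoot ζ ℓ →
      ∀ (A : Subfield E), (∀ s : S, algebraMap S E s ∈ A) → ζ ∈ A →
      ∀ (θ : E), θ ∉ A → θ ^ ℓ ∈ A → OE.valuation θ ≤ 1 →
        Module.finrank A (adjoin A ({θ} : Set E)) = ℓ → IsGalois A (adjoin A ({θ} : Set E)) →
        inertiaGroupIn OE (adjoin A ({θ} : Set E)) = ⊤ →
        (∃ t : Finset E, (t : Set E) ⊆ (adjoin A ({θ} : Set E)).toSubfield ∧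
          (adjoin A ({θ} : Set E)).toSubfield ≤
            Subfield.closure (Set.range (algebraMap S E) ∪ (t : Set E)) ∧
          ∃ hTO : (Algebra.adjoin S (t : Set E)).toSubring ≤ OE.toSubring,
            IsRegularLocalRing (Localization.AtPrime
              (Ideal.comap (Subring.inclusion hTO) (maximalIdeal OE)))) →
        (∃ t : Finset E, (t : Set E) ⊆ (adjoin A ({θ} : Set E)).toSubfield ∧
          (adjoin A ({θ} : Set E)).toSubfield ≤
            Subfield.closure (Set.range (algebraMap S E) ∪ (t : Set E)) ∧
          ∃ hTO : (Algebra.adjoin S (t : Set E)).toSubring ≤ OE.toSubring,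
            IsRegularLocalRing (Localization.AtPrime
              (Ideal.comap (Subring.inclusion hTO) (maximalIdeal OE))) ∧
            ∀ (τ : adjoin A ({θ} : Set E) ≃ₐ[A] adjoin A ({θ} : Set E))
              (x : adjoin A ({θ} : Set E)),
              (x : E) ∈ locAtCentre (Algebra.adjoin S (t : Set E)).toSubring OE →
              ((τ x : adjoin A ({θ} : Set E)) : E) ∈
                locAtCentre (Algebra.adjoin S (t : Set E)).toSubring OE))
    (hStabIη :
      ∀ (p : ℕ), p.Prime →
      ∀ (S : Type u) [CommRing S] [IsDomain S] [IsRegularLocalRing S],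
        IsExcellentRing S → ringKrullDim S = 3 → CharP (ResidueField S) p →
        IsAdicComplete (maximalIdeal S) S →
      ∀ (E : Type u) [Field E] [Algebra S E], Function.Injective (algebraMap S E) →
        IsAlgClosed E → Algebra.IsAlgebraic S E →
      ∀ (OE : ValuationSubring E), (∀ s : S, algebraMap S E s ∈ OE) →
        (∀ s ∈ maximalIdeal S, OE.valuation (algebraMap S E s) < 1) →
        (∀ y : OE, ∃ q : S[X], (∃ i, q.coeff i ∉ maximalIdeal S) ∧
          OE.valuation (q.eval₂ (algebraMap S E) y) < 1) →
      Nonempty OE.valuation.RankOne →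
      ∀ (M : Subfield E), (∀ s : S, algebraMap S E s ∈ M) →
      ∀ (N : IntermediateField M E) [FiniteDimensional M N] [IsGalois M N],
      ∀ (η : E), η ∈ OE → η ∈ (lift (fixedField (inertiaGroupIn OE N))).toSubfield →
        (∃ F : Polynomial E, F.Monic ∧
          (∀ k, F.coeff k ∈ OE ∧
            F.coeff k ∈ (lift (fixedField (decompositionGroupIn OE N))).toSubfield) ∧
          F.eval η = 0 ∧ OE.valuation ((derivative F).eval η) = 1) →
        (lift (fixedField (inertiaGroupIn OE N))).toSubfield =
          (IntermediateField.adjoin (lift (fixedField (decompositionGroupIn OE N))).toSubfield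
            ({η} : Set E)).toSubfield →
        (∃ t : Finset E, (t : Set E) ⊆ (lift (fixedField (inertiaGroupIn OE N))).toSubfield ∧
          (lift (fixedField (inertiaGroupIn OE N))).toSubfield ≤
            Subfield.closure (Set.range (algebraMap S E) ∪ (t : Set E)) ∧
          ∃ hTO : (Algebra.adjoin S (t : Set E)).toSubring ≤ OE.toSubring,
            IsRegularLocalRing (Localization.AtPrime
              (Ideal.comap (Subring.inclusion hTO) (maximalIdeal OE)))) →
        ∃ t : Finset E, (t : Set E) ⊆ (lift (fixedField (inertiaGroupIn OE N))).toSubfield ∧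
          (lift (fixedField (inertiaGroupIn OE N))).toSubfield ≤
            Subfield.closure (Set.range (algebraMap S E) ∪ (t : Set E)) ∧
          ∃ hTO : (Algebra.adjoin S (t : Set E)).toSubring ≤ OE.toSubring,
            IsRegularLocalRing (Localization.AtPrime
              (Ideal.comap (Subring.inclusion hTO) (maximalIdeal OE))) ∧
            (∀ τ ∈ decompositionGroupIn OE N, ∀ x : N,
              (x : E) ∈ locAtCentre (Algebra.adjoin S (t : Set E)).toSubring OE →
              ((τ x : N) : E) ∈ locAtCentre (Algebra.adjoin S (t : Set E)).toSubring OE) ∧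
            η ∈ locAtCentre (Algebra.adjoin S (t : Set E)).toSubring OE) :
    CossartPiltant2019ReductionP.{u} :=
  cossartPiltant2019ReductionP_of_cjs_of_stableInertia_of_monomialization hloc h44 hCJS hEmb
    hStabLoc hStabIη
    (fun p hp S _ _ _ hS hSdim _ _ E _ _ hinj _ halg OE hSO hdom hres _ M hSM N _ _ K' hMK' _ _ t
        htK' hTO hreg G hG hG0 hvG => by
      haveI := halg
      exact exists_monomialization_with_denominators hEmb hS hSdim hinj OE hSO hdom hres K'
        (fun s => hMK' (hSM s)) t htK' hTO hreg G hG hG0 hvG)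

end Literature.AlgebraicGeometry.Resolution

end
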